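import Summits.QuantumFields.BalabanUV.T4Continuum.Support.NE7CurvedLiftBookkeepingApprox
import Summits.QuantumFields.BalabanUV.T4Continuum.Support.NE7ExpansionRemainderCurvedStrong
import Summits.QuantumFields.BalabanUV.T4Continuum.Support.NE7TanCriticalGauge
import Summits.QuantumFields.BalabanUV.T4Continuum.Support.NE7ConvOneStepWeightedUnique
import Summits.QuantumFields.BalabanUV.T4Continuum.Spine.NE3.CurvedLandauRep
import HarnessLib

/-!
# NE7ApeCurvedRepDockingStrong — (APE) WITH A DATUM, THE EXPANSION LETTER IN CLOSING CURRENCY: F60's docking with (hEXP) DISCHARGED by the STRONG curved remainder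
# F65 — the displayed analytic letters are now exactly (L1) the normal lift (approximate NORTH), (L2) the slice solver, (L3) the background tension, (L4) the
# tangent transport, plus the GRADIENT MEMBER `α₁` of the Landau representative ([B8] (1.36)₂ TYPE — E′ supplies only the sup member)

Cell `pub-balaban`, rung (B)+1 sub-cell t4, lineage `b2b-balaban-t4-ne7-p1` (CRUX PROVER NE7 #1 = OWNER of row NE7), generation 75.  File F66 = F59
`NE7CurvedLiftBookkeepingApprox` ∘ row NE3's E′ `Spine/NE3/CurvedLandauRep.exists_landauRep_W` ∘ F65 `NE7ExpansionRemainderCurvedStrong.abs_dAction_vary_sub_dAction_sub_hess_le_W_strong`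
∘ F39 `NE7TanCriticalGauge.tanCritical_gaugeAct` ∘ `NE7ConvOneStepWeightedUnique.smallField_of_gaugeAct_eq`.

WHAT ([folklore]; 0 def, 0 sorry).  **`smallField_of_tanCritical_curvedLetters_W_strongExp`** — F60's statement with the weak `ρ_W` replaced by F65's strong
`ρ_W = #Plane·(2c_loc + 64α₀α₁ + 1024xα₀²)` (every term `O(M⁻³)` in the currencies `α₀ = α̂∕M`, `α₁ = α̂₁∕M²`, `x = b∕M²`, `NE7ExpansionRemainderCurvedCurrency.rhoW_strong_currency`) and ONE added
displayed letter: the forward covariant gradient member `‖Ad_{W(y+e_κ,τ)}Z(y+e_τ,κ) − Z(y,κ)‖ ≤ α₁` of every Landau representative with the sup member.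
HONEST FRAMING (page 1): composition; (L1) (L2) (L4) at a curved `W` and the gradient member are NOT proved; nothing of Bałaban's asserted ([Balaban1985Variational]
Sect. F TYPE); (APE) on curved data NOT proved; NOT ONE-STEP, NOT NE7; spine 0∕9; finite T⁴ rung (B)+1 — NOT infinite volume, NOT mass gap, NOT `BetaPertH`, NOT Clay.
Continuum YM on T⁴ ⇐ BetaPertH ∧ nine spine estimates (0/9 proved); BetaPertH ⇐ (D1) ∧ (D4) ∧ CAP+tail; G-an2-4 gates asym, D1 and NE2/3/4.
-/

set_option autoImplicit false

open scoped BigOperators Matrix Matrix.Norms.L2Operator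
open NormedSpace Finset Set

namespace Summit.QuantumFields.BalabanUV.T4Continuum.NE7ApeCurvedRepDockingStrong

open Literature.MathematicalPhysics.QuantumFieldTheory.Balaban1983to89
open B7Prop1Explicit B7Prop2Explicit MatrixLog UnitaryModel
open T4AveragingDeficitWall (Ad IsUnitaryCfg IsSkewDir SmallField vary curlAt dirL1)
open T4AveragingDeficitWallBoundary (IsPeriodicCfg periodBox)
open AveragingDeficitPeriodicCounting (IsPeriodicDir)
open AveragingDeficitMultiLevelPrep (LevelSmall)
open MinimalActionLevels (perWin)
open NE3HessForm (hess dAction)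
open NE3TangentCovariantTower (dirIter)
open NE3EnergyShapes (IsUnitarySite IsPeriodicSite)
open NE3CovariantWeitzenbock (covDiv)
open NE3RightInverseSupLetters (frameC)
open NE3.PairLandauB8 (IsLandauB8)
open NE3.CurvedLandauRep (exists_landauRep_W)
open NE7TanCriticalGauge (tanCritical_gaugeAct)
open NE7ConvOneStepWeightedUnique (smallField_of_gaugeAct_eq)
open NE7CurvedLiftBookkeepingApprox (smallField_vary_of_curvedLetters_approxNorth)
open NE7ExpansionRemainderCurvedStrong (abs_dAction_vary_sub_dAction_sub_hess_le_W_strong)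

noncomputable section

variable {d : ℕ} {n : Type*} [Fintype n] [DecidableEq n]

/-- **(APE) WITH A DATUM, EXPANSION LETTER IN CLOSING CURRENCY** (statement in the module docstring). [folklore] -/
theorem smallField_of_tanCritical_curvedLetters_W_strongExp [Nonempty n] (hd : 1 ≤ d) {L N : ℕ} [NeZero N] (hL : 2 ≤ L) (j : ℕ)
    -- the background
    {W : Site d → Fin d → (Matrix n n ℂ)ˣ} {x x₁ : ℝ} (hWu : IsUnitaryCfg W) (hWP : IsPeriodicCfg W ((N * L ^ (j + 1) : ℕ) : ℤ))
    (hx : 0 ≤ x) (hs : LevelSmall d L j x) (hWx : SmallField W x) (hx10 : 0 ≤ x₁)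
    (hgrad : ∀ (p : Site d) (μ κ : Fin d), κ ≠ μ →
      ‖Ad (W p μ) ((hol W (p + e μ) (plaqWord κ μ) : (Matrix n n ℂ)ˣ) : Matrix n n ℂ) - ((hol W p (plaqWord κ μ) : (Matrix n n ℂ)ˣ) : Matrix n n ℂ)‖ ≤ x₁)
    (hbx : 23040 * (d : ℝ) ^ 4 * (frameC d L + d) ^ 2 * ((L : ℝ) ^ (j + 1)) ^ 2 * x ≤ 1)
    (hcx : 11520 * (d : ℝ) ^ 4 * (frameC d L + d) ^ 3 * ((L : ℝ) ^ (j + 1)) ^ 3 * x₁ ≤ 1)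
    (hbx' : 256 * (d : ℝ) ^ 2 * ((L : ℝ) ^ (j + 1)) ^ 2 * x ≤ 1) (hcx' : 16 * (d : ℝ) * ((L : ℝ) ^ (j + 1)) ^ 3 * x₁ ≤ 1)
    -- the field: of the class, tangent-critical, (−1)/(−2)-close to `W`
    {U : Site d → Fin d → (Matrix n n ℂ)ˣ} (hUu : IsUnitaryCfg U) (hUP : IsPeriodicCfg U ((N * L ^ (j + 1) : ℕ) : ℤ))
    {xU : ℝ} (hxU : 0 ≤ xU) (hsU : LevelSmall d L j xU) (hUxU : SmallField U xU)
    (hcritU : ∀ Y : Site d → Fin d → Matrix n n ℂ, IsSkewDir Y → IsPeriodicDir Y ((N * L ^ (j + 1) : ℕ) : ℤ) →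
      dirIter L (j + 1) U Y = 0 → dAction U Y (perWin d (N * L ^ (j + 1))) = 0)
    {r₀ b₀ : ℝ} (hr₀ : ∀ (y : Site d) (μ : Fin d), ‖(((W y μ)⁻¹ * U y μ : (Matrix n n ℂ)ˣ) : (Matrix n n ℂ)) - 1‖ ≤ r₀)
    (hb₀ : ∀ x : Site d, ‖covDiv W (fun y μ => mlog (((W y μ)⁻¹ * U y μ : (Matrix n n ℂ)ˣ) : (Matrix n n ℂ))) x‖ ≤ b₀)
    (hreg₁ : (36 * (d : ℝ) * (frameC d L + d) ^ 2) * ((L : ℝ) ^ (j + 1)) ^ 2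
      * ((1 + 2 * (Fintype.card n : ℝ) * (64 * (d : ℝ) ^ 2 * N) ^ d + 27 * (Fintype.card n : ℝ) ^ 3 * (512 : ℝ) ^ d * (N : ℝ) ^ d) * b₀) ≤ 1 / 10)
    (hreg₂ : (36 * (d : ℝ) * (frameC d L + d)) * (L : ℝ) ^ (j + 1)
      * ((1 + 2 * (Fintype.card n : ℝ) * (64 * (d : ℝ) ^ 2 * N) ^ d + 27 * (Fintype.card n : ℝ) ^ 3 * (512 : ℝ) ^ d * (N : ℝ) ^ d) * b₀) ≤ 1 / 25)
    (hreg₃ : r₀ + 5 / 2 * ((36 * (d : ℝ) * (frameC d L + d)) * (L : ℝ) ^ (j + 1)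
      * ((1 + 2 * (Fintype.card n : ℝ) * (64 * (d : ℝ) ^ 2 * N) ^ d + 27 * (Fintype.card n : ℝ) ^ 3 * (512 : ℝ) ^ d * (N : ℝ) ^ d) * b₀)) ≤ 1 / 20)
    (hline : (1 + 2 * (Fintype.card n : ℝ) * (64 * (d : ℝ) ^ 2 * N) ^ d + 27 * (Fintype.card n : ℝ) ^ 3 * (512 : ℝ) ^ d * (N : ℝ) ^ d)
      * (4 * ((36 * (d : ℝ) * (frameC d L + d) ^ 2) * ((L : ℝ) ^ (j + 1)) ^ 2)
          * (b₀ + 4 * ((1 + 2 * (Fintype.card n : ℝ) * (64 * (d : ℝ) ^ 2 * N) ^ d + 27 * (Fintype.card n : ℝ) ^ 3 * (512 : ℝ) ^ d * (N : ℝ) ^ d) * b₀))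
        + 25 * d * (r₀ + 5 / 2 * ((36 * (d : ℝ) * (frameC d L + d)) * (L : ℝ) ^ (j + 1)
            * ((1 + 2 * (Fintype.card n : ℝ) * (64 * (d : ℝ) ^ 2 * N) ^ d + 27 * (Fintype.card n : ℝ) ^ 3 * (512 : ℝ) ^ d * (N : ℝ) ^ d) * b₀)))
            * ((36 * (d : ℝ) * (frameC d L + d)) * (L : ℝ) ^ (j + 1))
        + 14 * d * ((36 * (d : ℝ) * (frameC d L + d)) * (L : ℝ) ^ (j + 1)) ^ 2
            * ((1 + 2 * (Fintype.card n : ℝ) * (64 * (d : ℝ) ^ 2 * N) ^ d + 27 * (Fintype.card n : ℝ) ^ 3 * (512 : ℝ) ^ d * (N : ℝ) ^ d) * b₀)) ≤ 1 / 2)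
    -- the sup radius of the representative
    {α₀ : ℝ} (hα0 : 0 ≤ α₀) (hα₀ : 2 * (r₀ + 5 / 2 * ((36 * (d : ℝ) * (frameC d L + d)) * (L : ℝ) ^ (j + 1)
        * ((1 + 2 * (Fintype.card n : ℝ) * (64 * (d : ℝ) ^ 2 * N) ^ d + 27 * (Fintype.card n : ℝ) ^ 3 * (512 : ℝ) ^ d * (N : ℝ) ^ d) * b₀))) ≤ α₀)
    -- the four remaining analytic letters at `W`
    (S : Set (Site d → Fin d → Matrix n n ℂ)) {cN KG κ τ ν : ℝ} (hκ : 0 ≤ κ) (hτ : 0 ≤ τ) (hν : 0 ≤ ν)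
    (hNlift : ∀ Z : Site d → Fin d → Matrix n n ℂ, IsSkewDir Z → IsPeriodicDir Z ((N * L ^ (j + 1) : ℕ) : ℤ) →
      IsLandauB8 (d := d) L N (j + 1) W Z → (∀ y μ, ‖Z y μ‖ ≤ α₀) →
      ∃ AN : Site d → Fin d → Matrix n n ℂ, IsPeriodicDir AN ((N * L ^ (j + 1) : ℕ) : ℤ) ∧
        dirIter L (j + 1) W AN = dirIter L (j + 1) W Z ∧
        (∀ z μ' ν', μ' ≠ ν' → ‖curlAt W AN z μ' ν'‖ ≤ cN) ∧
        (∀ Y : Site d → Fin d → Matrix n n ℂ, IsSkewDir Y → IsPeriodicDir Y ((N * L ^ (j + 1) : ℕ) : ℤ) → dirIter L (j + 1) W Y = 0 →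
          |hess W AN Y (perWin d (N * L ^ (j + 1)))| ≤ ν * dirL1 Y (periodBox (d := d) (N * L ^ (j + 1)))) ∧
        (fun y μ => Z y μ - AN y μ) ∈ S)
    {α₁ : ℝ} (hα1 : 0 ≤ α₁)
    (hGrad : ∀ Z : Site d → Fin d → Matrix n n ℂ, IsSkewDir Z → IsPeriodicDir Z ((N * L ^ (j + 1) : ℕ) : ℤ) →
      IsLandauB8 (d := d) L N (j + 1) W Z → (∀ y μ, ‖Z y μ‖ ≤ α₀) →
      ∀ (y : Site d) (κ τ : Fin d), ‖Ad (W (y + e κ) τ) (Z (y + e τ) κ) - Z y κ‖ ≤ α₁)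
    (hG : ∀ X ∈ S, IsPeriodicDir X ((N * L ^ (j + 1) : ℕ) : ℤ) → dirIter L (j + 1) W X = 0 → ∀ g : ℝ, 0 ≤ g →
      (∀ Y : Site d → Fin d → Matrix n n ℂ, IsSkewDir Y → IsPeriodicDir Y ((N * L ^ (j + 1) : ℕ) : ℤ) → dirIter L (j + 1) W Y = 0 →
        |hess W X Y (perWin d (N * L ^ (j + 1)))| ≤ g * dirL1 Y (periodBox (d := d) (N * L ^ (j + 1)))) →
      ∀ z μ' ν', μ' ≠ ν' → ‖curlAt W X z μ' ν'‖ ≤ KG * g)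
    (hWten : ∀ Y : Site d → Fin d → Matrix n n ℂ, IsSkewDir Y → IsPeriodicDir Y ((N * L ^ (j + 1) : ℕ) : ℤ) → dirIter L (j + 1) W Y = 0 →
      |dAction W Y (perWin d (N * L ^ (j + 1)))| ≤ κ * dirL1 Y (periodBox (d := d) (N * L ^ (j + 1))))
    (hTT : ∀ Z : Site d → Fin d → Matrix n n ℂ, IsSkewDir Z → IsPeriodicDir Z ((N * L ^ (j + 1) : ℕ) : ℤ) →
      IsLandauB8 (d := d) L N (j + 1) W Z → (∀ y μ, ‖Z y μ‖ ≤ α₀) →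
      ∀ Y : Site d → Fin d → Matrix n n ℂ, IsSkewDir Y → IsPeriodicDir Y ((N * L ^ (j + 1) : ℕ) : ℤ) → dirIter L (j + 1) W Y = 0 →
      ∃ Y' : Site d → Fin d → Matrix n n ℂ, IsSkewDir Y' ∧ IsPeriodicDir Y' ((N * L ^ (j + 1) : ℕ) : ℤ) ∧ dirIter L (j + 1) (vary W Z 1) Y' = 0 ∧
        |dAction (vary W Z 1) (fun y μ => Y' y μ - Y y μ) (perWin d (N * L ^ (j + 1)))| ≤ τ * dirL1 Y (periodBox (d := d) (N * L ^ (j + 1)))) :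
    SmallField U (x + (KG * (τ + (Fintype.card (T4AveragingDeficitWall.Plane d) : ℝ)
          * (2 * (240 * (Real.exp α₀ - 1) * α₀ * (2 * α₁ + 24 * α₀ * (Real.exp α₀ - 1) + x) + 8 * α₀ * (2 * α₁ + 24 * α₀ * (Real.exp α₀ - 1))
              + 6 * (Real.exp α₀ - 1) * (2 * α₁ + 24 * (Real.exp α₀ - 1) * α₀)
              + (2 * α₁ + 24 * (Real.exp α₀ - 1) * α₀) * (2 * α₁ + 24 * α₀ * (Real.exp α₀ - 1))
              + 960 * (Real.exp α₀ - 1) * α₀ ^ 2 + 32 * x * α₀ ^ 2)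
            + (64 * α₀ * α₁ + 1024 * x * α₀ ^ 2)) + κ + ν) + cN + 28 * α₀ ^ 2)) := by
  have hP : 1 ≤ N * L ^ (j + 1) := Nat.mul_pos (Nat.pos_of_ne_zero (NeZero.ne N)) (Nat.pow_pos (by omega))
  have hPP : IsPeriodicCfg W (((N * L ^ (j + 1) : ℕ)) : ℤ) := hWP
  have hρ0 : 0 ≤ (Fintype.card (T4AveragingDeficitWall.Plane d) : ℝ)
          * (2 * (240 * (Real.exp α₀ - 1) * α₀ * (2 * α₁ + 24 * α₀ * (Real.exp α₀ - 1) + x) + 8 * α₀ * (2 * α₁ + 24 * α₀ * (Real.exp α₀ - 1))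
              + 6 * (Real.exp α₀ - 1) * (2 * α₁ + 24 * (Real.exp α₀ - 1) * α₀)
              + (2 * α₁ + 24 * (Real.exp α₀ - 1) * α₀) * (2 * α₁ + 24 * α₀ * (Real.exp α₀ - 1))
              + 960 * (Real.exp α₀ - 1) * α₀ ^ 2 + 32 * x * α₀ ^ 2)
            + (64 * α₀ * α₁ + 1024 * x * α₀ ^ 2)) := by
    have hδ0 : 0 ≤ Real.exp α₀ - 1 := by have := Real.add_one_le_exp α₀; linarith
    positivity
  have hL1 : 1 ≤ L := by omega
  -- brick E′: the Landau representative relative to `W`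
  obtain ⟨u, Z, huU, huP, hZs, hZP, hrep, hLan, -, hZsup, -, -⟩ :=
    exists_landauRep_W hd hL j hWu hWP hx hs hWx hx10 hgrad hbx hcx hbx' hcx' hUu hUP hr₀ hb₀ hreg₁ hreg₂ hreg₃ hline
  have hZα : ∀ y μ, ‖Z y μ‖ ≤ α₀ := fun y μ => (hZsup y μ).trans hα₀
  -- tangent-criticality is gauge covariant
  have hcrit' : ∀ Y' : Site d → Fin d → Matrix n n ℂ, IsSkewDir Y' → IsPeriodicDir Y' ((N * L ^ (j + 1) : ℕ) : ℤ) →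
      dirIter L (j + 1) (vary W Z 1) Y' = 0 → dAction (vary W Z 1) Y' (perWin d (N * L ^ (j + 1))) = 0 := by
    rw [← hrep]
    exact tanCritical_gaugeAct hL1 j hUu hxU hsU hUxU huU huP hcritU
  -- the letters at this representative; hEXP by F56
  obtain ⟨AN, hNP, hNexact, hN7, hNorth, hTS⟩ := hNlift Z hZs hZP hLan hZα
  have hZ1 := hGrad Z hZs hZP hLan hZα
  have hEXP : ∀ Y : Site d → Fin d → Matrix n n ℂ, IsSkewDir Y → IsPeriodicDir Y ((N * L ^ (j + 1) : ℕ) : ℤ) →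
      |dAction (vary W Z 1) Y (perWin d (N * L ^ (j + 1))) - dAction W Y (perWin d (N * L ^ (j + 1))) - hess W Z Y (perWin d (N * L ^ (j + 1)))|
        ≤ (Fintype.card (T4AveragingDeficitWall.Plane d) : ℝ)
          * (2 * (240 * (Real.exp α₀ - 1) * α₀ * (2 * α₁ + 24 * α₀ * (Real.exp α₀ - 1) + x) + 8 * α₀ * (2 * α₁ + 24 * α₀ * (Real.exp α₀ - 1))
              + 6 * (Real.exp α₀ - 1) * (2 * α₁ + 24 * (Real.exp α₀ - 1) * α₀)
              + (2 * α₁ + 24 * (Real.exp α₀ - 1) * α₀) * (2 * α₁ + 24 * α₀ * (Real.exp α₀ - 1))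
              + 960 * (Real.exp α₀ - 1) * α₀ ^ 2 + 32 * x * α₀ ^ 2)
            + (64 * α₀ * α₁ + 1024 * x * α₀ ^ 2))
          * dirL1 Y (periodBox (d := d) (N * L ^ (j + 1))) :=
    fun Y _ hYP => abs_dAction_vary_sub_dAction_sub_hess_le_W_strong hP hWu hPP hx hWx hZs hZP hα0 hα1 hZα hZ1 hYP
  -- F59 on the representative
  have hSF := smallField_vary_of_curvedLetters_approxNorth hL1 j hWu hx hs hWx hZs hZP hZα hNP hNexact hN7 hν hNorth S hTS hG hρ0 hEXP hκ hWten
    hcrit' hτ (hTT Z hZs hZP hLan hZα)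
  -- the radius is gauge invariant
  exact smallField_of_gaugeAct_eq huU hrep hSF

end

end Summit.QuantumFields.BalabanUV.T4Continuum.NE7ApeCurvedRepDockingStrong

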